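import Mathlib.Combinatorics.Matroid.Minor.Delete

/-!
# PercRepro — the e-free core is closed under deletion (p1, gen 20; the s₄ side's first lemma)

p2's hypothesis `hfree`: every point `e` has a partition `A ⊔ ((E ∖ e) ∖ A)` of the other points with `e` in
neither closure. It survives deleting any point: `(M ＼ {x}).closure S = M.closure (S ∖ {x}) ∖ {x} ⊆ M.closure S`.
Axioms: standard.
-/

open scoped Matroid

namespace PercRepro

namespace S1

open Set

variable {α : Type}

/-- `hfree` at every point survives the deletion of a point (the class of e-free cores is deletion-closed). -/
theorem hfree_delete (M : Matroid α)
    (hfree : ∀ e ∈ M.E, ∃ A ⊆ M.E \ {e}, e ∉ M.closure A ∧ e ∉ M.closure ((M.E \ {e}) \ A)) (x : α) :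
    ∀ e ∈ (M ＼ {x}).E, ∃ A ⊆ (M ＼ {x}).E \ {e},
      e ∉ (M ＼ {x}).closure A ∧ e ∉ (M ＼ {x}).closure (((M ＼ {x}).E \ {e}) \ A) := by
  intro e he
  rw [_root_.Matroid.delete_ground] at he
  obtain ⟨A, hA, h1, h2⟩ := hfree e he.1
  refine ⟨A \ {x}, ?_, ?_, ?_⟩
  · rw [_root_.Matroid.delete_ground]
    intro z hz
    have := hA hz.1
    exact ⟨⟨this.1, hz.2⟩, this.2⟩
  · rw [_root_.Matroid.delete_closure_eq]
    intro h
    exact h1 (M.closure_subset_closure (sdiff_subset.trans sdiff_subset) h.1)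
  · rw [_root_.Matroid.delete_closure_eq, _root_.Matroid.delete_ground]
    intro h
    refine h2 (M.closure_subset_closure ?_ h.1)
    intro z hz
    obtain ⟨⟨⟨⟨hzE, hzx⟩, hze⟩, hzA⟩, _⟩ := hz
    exact ⟨⟨hzE, hze⟩, fun hzA' => hzA ⟨hzA', hzx⟩⟩

end S1

end PercRepro
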